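/- Copyright: ym-fleet seat `ym-infvol-p3` (prover, g4), for crux `HistoryTail` (stmt-QuantumFields-18916) of route
`UnitScaleTilt`, STUB 3 «chessboard ∕ reflection positivity» of the v5′ skeleton.  Released under the licence of the
surrounding project. -/
import Summits.QuantumFields.YangMills.Theorems.UnitScaleTiltHistoryTailChessboardOnePlaquette

/-!
# Chessboard for ONE top-level plaquette of the Gibbs tower, file 4: a SEPARATED mirror family through ANY plaquette

Support file (helper lemmas, `--supports stmt-QuantumFields-18916`) for STUB 3 `stub_chessboardRP` of the v5′ birth
skeleton of crux `HistoryTail` (route `UnitScaleTilt`).  File 3 bounds the Gibbs probability of a `dist1`-event of the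
`K`-fold averaged plaquette variable at `p` by the `N^d`-th root of the joint event over the mirror copies of `p`, for
`p` with its far corners inside its cube of the grid anchored at the origin.  STUB 3 wants the copies PAIRWISE SEPARATED
(its dilute-family partner, STUB 4, pays `e^{−¼p²}` per member) and `p` ARBITRARY.  Both come from placing `p` at the
CENTRE of a cube: by the translation invariance of the Gibbs state and the block-translation covariance of the
averagings (`T4Continuum.iter_translate` over `blockAvg_translate`) the event of `p` has the probability of the event of
any level-`K` translate of `p`; we translate `p` to the centre of the reference cube, take the mirror family there
(file 2) and translate it back.  For a centred plaquette, adjacent copies are mirror images at `ℓ¹`-torus distance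
`≥ M − 1` (`Site.tdist`), and non-adjacent ones are `≥ M + 1` apart.  General `P : Params` throughout.

WHAT.  §1 `Site.tdist` under translations and its coordinate lower bound; §2 SEPARATION of the mirror family of a
centred plaquette (`le_tdist_mirror`: `c ≠ c' → M − 1 ≤ tdist`), via the closed form of the label differences
(`mirrorSrc_sub_eq`) and the parity flip between adjacent cubes; §3 the CENTRING translation (`centreVec`) and its
offsets; §4 Gibbs probabilities of `dist1`-events of `Ū^K` are invariant under level-`K` translations of the plaquettes
(`gibbs_real_iter_translate`); §5 **`exists_separated_mirror_family`** — for EVERY top plaquette `p` (cube side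
`M ≥ 2`): an injective family `q : BlockIdx P.d N → Plaq P K` through `p`, same directions, pairwise
`tdist ≥ M − 1`, with `Gibbs{dist1 Ū^K(∂p) ∈ B} ≤ Gibbs{∀ c, dist1 Ū^K(∂(q c)) ∈ B}^{1∕N^d}`.

HONEST SCOPE.  Finite-torus bookkeeping over tree theorems (files 1–3 and the T⁴ cell's History chessboard road); no
estimate of Bałaban's papers is used or asserted; the crux and its route stay CONDITIONAL on the (α) input package.
Not infinite volume, not a gap, not Clay.
-/

namespace Summit.QuantumFields.YangMills.Theorems.HistoryTailChessboardFamily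

open MeasureTheory Finset
open Literature.Barriers.CriticalPhenomena.NonGibbs
open Literature.MathematicalPhysics.QuantumFieldTheory
open Literature.MathematicalPhysics.QuantumFieldTheory.Balaban1983to89
open BlockAveraging T4UndoubledRP
open Summit.QuantumFields.BalabanUV.T4Continuum
open HistoryRPTowerCuts HistoryChessboardEventsSplit HistoryChessboardEventsCubes HistoryChessboardEventsCubeSites
open HistoryChessboardPlaquetteBox
open Summit.QuantumFields.YangMills.Theorems.HistoryTailChessboardTopField
open Summit.QuantumFields.YangMills.Theorems.HistoryTailChessboardMirror
open Summit.QuantumFields.YangMills.Theorems.HistoryTailChessboardOnePlaquette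

noncomputable section

variable {P : Params} {K M N : ℕ}

/-! ## §1 The `ℓ¹` torus distance: translation invariance and the coordinate lower bound -/

section TDist

/-- `tdist` is translation invariant. [folklore] -/
theorem tdist_add_right (x y a : Site P K) : Site.tdist (x + a) (y + a) = Site.tdist x y := by
  unfold Site.tdist
  refine sum_congr rfl fun μ _ => ?_
  rw [Site.add_apply, Site.add_apply, add_sub_add_right_eq_sub, add_sub_add_right_eq_sub]

/-- one coordinate's torus distance bounds `tdist` from below. [folklore] -/
theorem min_val_le_tdist (x y : Site P K) (j : Fin P.d) :
    min (x j - y j).val (y j - x j).val ≤ Site.tdist x y := by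
  unfold Site.tdist
  exact single_le_sum (f := fun μ => min (x μ - y μ).val (y μ - x μ).val) (fun μ _ => Nat.zero_le _) (mem_univ j)

end TDist

/-! ## §2 Separation of the mirror family of a centred plaquette -/

section Separation

variable (h : P.sitesPerDir K = M * N) (hN : Even N) {p : Plaq P K}
variable (hp : ∀ j : Fin P.d, baseOffset M p j + extent p j < M)

/-- `cubeCut` is subtractive (file 2's `mulIdx_sub` through the ring isomorphism). [folklore] -/
theorem cubeCut_sub [NeZero N] (a b : ZMod N) : cubeCut h (a - b) = cubeCut h a - cubeCut h b := by
  rw [cubeCut_eq, cubeCut_eq, cubeCut_eq, mulIdx_sub, map_sub]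

include hp in
/-- **THE LABEL DIFFERENCE OF TWO COPIES IN CLOSED FORM**: for cubes differing in direction `j`,
`(x_j − x'_j).val = M·(c_j − c'_j).val + offset − offset'` (no wrap-around: the right side lies in `[1, M·N − 1]`).
[folklore] -/
theorem val_mirrorSrc_sub [NeZero N] {c c' : BlockIdx P.d N} {j : Fin P.d} (hj : c j ≠ c' j) :
    (mirrorSrc h hN p c j - mirrorSrc h hN p c' j).val =
      M * (c j - c' j).val + offset M hN p c j - offset M hN p c' j := by
  have hδ : 1 ≤ (c j - c' j).val := by
    rw [Nat.one_le_iff_ne_zero]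
    intro h0
    exact hj (sub_eq_zero.1 ((ZMod.val_eq_zero _).1 h0))
  have ho := offset_lt hN hp c j
  have ho' := offset_lt hN hp c' j
  have hle : offset M hN p c' j ≤ M * (c j - c' j).val + offset M hN p c j := by nlinarith
  have hlt : M * (c j - c' j).val + offset M hN p c j - offset M hN p c' j < P.sitesPerDir K := by
    have h1 : (c j - c' j).val + 1 ≤ N := ZMod.val_lt _
    have : M * (c j - c' j).val + offset M hN p c j < M * N := by
      calc M * (c j - c' j).val + offset M hN p c j < M * (c j - c' j).val + M := by omega
        _ = M * ((c j - c' j).val + 1) := by ring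
        _ ≤ M * N := Nat.mul_le_mul_left M h1
    rw [h]; omega
  have hc : ((M : ZMod (P.sitesPerDir K)) * (((c j - c' j).val : ℕ) : ZMod (P.sitesPerDir K))) =
      cubeCut h (c j) - cubeCut h (c' j) := by
    rw [← cubeCut_sub, ← ZMod.natCast_zmod_val (cubeCut h (c j - c' j)), val_cubeCut, Nat.cast_mul]
  have e : mirrorSrc h hN p c j - mirrorSrc h hN p c' j =
      ((M * (c j - c' j).val + offset M hN p c j - offset M hN p c' j : ℕ) : ZMod (P.sitesPerDir K)) := by
    rw [mirrorSrc_apply, mirrorSrc_apply, Nat.cast_sub hle]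
    push_cast
    linear_combination -hc
  rw [e, ZMod.val_natCast_of_lt hlt]

/-- adjacent cube indices have opposite parities (`N` even). [folklore] -/
theorem parity_ne_of_sub_eq_one [NeZero N] {t t' : ZMod N} (h1 : t - t' = 1) : parity hN t ≠ parity hN t' := by
  have e : t = t' + 1 := by rw [← h1]; ring
  rw [e, map_add, map_one]
  generalize parity hN t' = x
  revert x
  decide

variable (hcen : ∀ j : Fin P.d, M ≤ 2 * baseOffset M p j + extent p j + 2 ∧ 2 * baseOffset M p j + extent p j ≤ M)
include hp hcen

/-- **ONE-SIDED SEPARATION**: for cubes differing in direction `j`, `M − 1 ≤ (x_j − x'_j).val` — cubes two or more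
apart contribute `≥ M + 1`; ADJACENT cubes have opposite parities, so the two offsets are the two branches `r` and
`M − 1 − r − e` of file 2's `offset`, and the centring hypothesis gives `2r + e + 1 ≥ M − 1`, `2M − 1 − 2r − e ≥ M − 1`.
[folklore] -/
theorem le_val_mirrorSrc_sub [NeZero N] {c c' : BlockIdx P.d N} {j : Fin P.d} (hj : c j ≠ c' j) :
    M - 1 ≤ (mirrorSrc h hN p c j - mirrorSrc h hN p c' j).val := by
  rw [val_mirrorSrc_sub h hN hp hj]
  have ho := offset_lt hN hp c j
  have ho' := offset_lt hN hp c' j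
  have hδ : 1 ≤ (c j - c' j).val := by
    rw [Nat.one_le_iff_ne_zero]
    intro h0
    exact hj (sub_eq_zero.1 ((ZMod.val_eq_zero _).1 h0))
  by_cases h2 : 2 ≤ (c j - c' j).val
  · have h2M : M * 2 ≤ M * (c j - c' j).val := Nat.mul_le_mul_left M h2
    omega
  · -- adjacent cubes
    have h1 : (c j - c' j).val = 1 := by omega
    have hsub : c j - c' j = 1 := by
      rw [← ZMod.natCast_zmod_val (c j - c' j), h1, Nat.cast_one]
    have hpar : parity hN (c j) ≠ parity hN (c' j) := parity_ne_of_sub_eq_one hN hsub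
    obtain ⟨hc1, hc2⟩ := hcen j
    have hpj := hp j
    rw [h1, mul_one]
    unfold offset
    by_cases hq : parity hN (c j) = parity hN (cubeOf M N p.src j)
    · have hq' : ¬ parity hN (c' j) = parity hN (cubeOf M N p.src j) := fun h' => hpar (hq.trans h'.symm)
      rw [if_pos hq, if_neg hq']
      omega
    · by_cases hq' : parity hN (c' j) = parity hN (cubeOf M N p.src j)
      · rw [if_neg hq, if_pos hq']
        omega
      · -- both differ from the reference parity: impossible in `ZMod 2`
        exfalso
        apply hpar
        generalize parity hN (c j) = x at hq
        generalize parity hN (c' j) = y at hq'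
        generalize parity hN (cubeOf M N p.src j) = z at hq hq'
        revert x y z
        decide

/-- **THE MIRROR COPIES OF A CENTRED PLAQUETTE ARE PAIRWISE `(M − 1)`-SEPARATED** in the `ℓ¹` torus distance of their
base points. [folklore] -/
theorem le_tdist_mirror [NeZero N] {c c' : BlockIdx P.d N} (hcc' : c ≠ c') :
    M - 1 ≤ Site.tdist (mirror h hN p c).src (mirror h hN p c').src := by
  obtain ⟨j, hj⟩ := Function.ne_iff.1 hcc'
  refine le_trans ?_ (min_val_le_tdist _ _ j)
  rw [mirror_src, mirror_src]
  exact le_min (le_val_mirrorSrc_sub h hN hp hcen hj) (le_val_mirrorSrc_sub h hN hp hcen (Ne.symm hj))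

end Separation

/-! ## §3 Centring a plaquette in the reference cube -/

section Centre

variable (M) in
/-- the CENTRED OFFSET in direction `j`: `⌊(M − 1 − e_j) ∕ 2⌋`. -/
def centreOffset (p : Plaq P K) (j : Fin P.d) : ℕ := (M - 1 - extent p j) / 2

variable (M) in
/-- the CENTRING VECTOR: translating `p` by it puts its base point at the centred offsets of the reference cube. -/
def centreVec (p : Plaq P K) : Site P K := fun j => ((centreOffset M p j : ℕ) : ZMod (P.sitesPerDir K)) - p.src j

/-- the extent of a translate is the extent. [folklore] -/
@[simp] theorem extent_translate (p : Plaq P K) (a : Site P K) (j : Fin P.d) : extent (p.translate a) j = extent p j := rfl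

/-- `extent ≤ 1`. [folklore] -/
theorem extent_le_one (p : Plaq P K) (j : Fin P.d) : extent p j ≤ 1 := by
  unfold extent; split_ifs <;> omega

variable (h : P.sitesPerDir K = M * N) [NeZero N]
include h

/-- the centred offset is a label (`< sitesPerDir K`). [folklore] -/
theorem centreOffset_lt (p : Plaq P K) (j : Fin P.d) : centreOffset M p j < P.sitesPerDir K := by
  have hM : M ≤ P.sitesPerDir K := by
    rw [h]; exact Nat.le_mul_of_pos_right M (Nat.pos_of_ne_zero (NeZero.ne N))
  have : centreOffset M p j < M ∨ M = 0 := by unfold centreOffset; omega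
  rcases this with h1 | h0
  · exact lt_of_lt_of_le h1 hM
  · exact absurd h0 (pos_of_sitesPerDir_eq h).ne'

/-- **THE BASE OFFSETS OF THE CENTRED TRANSLATE ARE THE CENTRED OFFSETS.** [folklore] -/
theorem baseOffset_translate_centreVec (p : Plaq P K) (j : Fin P.d) :
    baseOffset M (p.translate (centreVec M p)) j = centreOffset M p j := by
  have hlt : centreOffset M p j < M := by
    have := pos_of_sitesPerDir_eq h
    unfold centreOffset; omega
  unfold baseOffset
  show ((p.src + centreVec M p) j).val % M = _
  rw [Site.add_apply]
  unfold centreVec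
  rw [add_sub_cancel, ZMod.val_natCast_of_lt (centreOffset_lt h p j), Nat.mod_eq_of_lt hlt]

omit [NeZero N] h in
/-- the centred offsets satisfy file 2's standing hypothesis and §2's centring hypothesis (`M ≥ 2`). [folklore] -/
theorem centreOffset_bounds (hM : 2 ≤ M) (p : Plaq P K) (j : Fin P.d) :
    centreOffset M p j + extent p j < M ∧ M ≤ 2 * centreOffset M p j + extent p j + 2 ∧
      2 * centreOffset M p j + extent p j ≤ M := by
  have he := extent_le_one p j
  unfold centreOffset
  omega

end Centre

/-! ## §4 Gibbs probabilities of `Ū^K`-events are invariant under translations of the plaquettes -/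

section Invariance

variable {n : ℕ} [NeZero n]

/-- **TRANSLATING THE READING OF `Ū^K` DOES NOT CHANGE ITS GIBBS PROBABILITY**: `Gibbs{τ_b Ū^K ∈ S} = Gibbs{Ū^K ∈ S}`
for every level-`K` vector `b` (the Gibbs state is invariant under the fine translation `L^K·b`,
`measurePreserving_gibbsMeasure_of_isExpectSymmetry`; the averagings intertwine it with `τ_b`, `T4Continuum.iter_translate`
over `blockAvg_translate`). [folklore] -/
theorem gibbs_real_iter_translate (P : Params) {β : ℝ} (hβ : 0 ≤ β)
    (ℰ : ℕ → LoopAverage (Matrix.specialUnitaryGroup (Fin n) ℂ))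
    (hE : ∀ k l, Measurable fun W : Fin (l + 1) → Matrix.specialUnitaryGroup (Fin n) ℂ => (ℰ k).E W)
    (K : ℕ) {S : Set (GaugeField P K (Matrix.specialUnitaryGroup (Fin n) ℂ))} (hS : MeasurableSet S) (b : Site P K) :
    (T4GenFunBounds.gibbsMeasure (G := Matrix.specialUnitaryGroup (Fin n) ℂ) P β).real
        {U | (Averaging.iter (fun k => blockAvg (P := P) (j := k) (ℰ k)) K U).translate b ∈ S} =
      (T4GenFunBounds.gibbsMeasure (G := Matrix.specialUnitaryGroup (Fin n) ℂ) P β).real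
        {U | Averaging.iter (fun k => blockAvg (P := P) (j := k) (ℰ k)) K U ∈ S} := by
  have hA : ∀ k, Measurable (blockAvg (P := P) (j := k) (ℰ k)).avg := fun k => measurable_avgFun (ℰ k) (hE k)
  have hiter : Measurable (Averaging.iter (fun k => blockAvg (P := P) (j := k) (ℰ k)) K) :=
    T4Continuum.measurable_iter _ hA K
  have hT : MeasurePreserving (GaugeField.translate (G := Matrix.specialUnitaryGroup (Fin n) ℂ) (Site.scaleTo K b))
      (T4GenFunBounds.gibbsMeasure (G := Matrix.specialUnitaryGroup (Fin n) ℂ) P β)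
      (T4GenFunBounds.gibbsMeasure (G := Matrix.specialUnitaryGroup (Fin n) ℂ) P β) :=
    HistoryRPGibbsState.measurePreserving_gibbsMeasure_of_isExpectSymmetry hβ (measurable_translate _)
      (Missing.IsExpectSymmetry.translate _)
  have e : {U : GaugeField P 0 (Matrix.specialUnitaryGroup (Fin n) ℂ) |
      (Averaging.iter (fun k => blockAvg (P := P) (j := k) (ℰ k)) K U).translate b ∈ S} =
      GaugeField.translate (Site.scaleTo K b) ⁻¹'
        {U | Averaging.iter (fun k => blockAvg (P := P) (j := k) (ℰ k)) K U ∈ S} := by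
    ext U
    simp only [Set.mem_setOf_eq, Set.mem_preimage]
    rw [T4Continuum.iter_translate _ (fun j a V => blockAvg_translate (ℰ j) a V) K b U]
  have hS' : MeasurableSet {U : GaugeField P 0 (Matrix.specialUnitaryGroup (Fin n) ℂ) |
      Averaging.iter (fun k => blockAvg (P := P) (j := k) (ℰ k)) K U ∈ S} := hS.preimage hiter
  simp only [Measure.real]
  rw [e, hT.measure_preimage hS'.nullMeasurableSet]

end Invariance

/-! ## §5 A separated mirror family through any plaquette, with the chessboard bound -/

section Family

variable {n : ℕ} [NeZero n] [NeZero N]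

/-- **A SEPARATED MIRROR FAMILY THROUGH ANY TOP PLAQUETTE, WITH THE MULTIPLE-REFLECTION BOUND** — the content of
`HistoryTail`'s STUB 3 for a general `P : Params`: `SU(n)` Wilson–Gibbs state at `β ≥ 0`, measurable small-loop averages,
height `K ≤ m + K_P`, cubes of side `M ≥ 2` of the level-`K` lattice (`sitesPerDir K = M·N`, `N` even), measurable
`B ⊆ ℝ`.  For EVERY top plaquette `p` there is an injective family `q : BlockIdx P.d N → Plaq P K` of plaquettes of the
directions of `p`, through `p`, pairwise `(M − 1)`-separated in the `ℓ¹` torus distance of base points, with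
`Gibbs{dist1 Ū^K(∂p) ∈ B} ≤ Gibbs{∀ c, dist1 Ū^K(∂(q c)) ∈ B} ^ (1 ∕ N^d)` (centre `p` by a translation, take file 2's
mirror family, translate back; file 3's bound + §4's invariance). [folklore] -/
theorem exists_separated_mirror_family (P : Params) {β : ℝ} (hβ : 0 ≤ β)
    (ℰ : ℕ → LoopAverage (Matrix.specialUnitaryGroup (Fin n) ℂ))
    (hE : ∀ k l, Measurable fun W : Fin (l + 1) → Matrix.specialUnitaryGroup (Fin n) ℂ => (ℰ k).E W)
    (K : ℕ) (hK : K ≤ P.m + P.K) (h : P.sitesPerDir K = M * N) (hN : Even N) (hM : 2 ≤ M)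
    {B : Set ℝ} (hB : MeasurableSet B) (p : Plaq P K) :
    ∃ q : BlockIdx P.d N → Plaq P K, Function.Injective q ∧ (∃ c₀, q c₀ = p) ∧
      (∀ c, (q c).μ = p.μ ∧ (q c).ν = p.ν) ∧
      (∀ c c', c ≠ c' → M - 1 ≤ Site.tdist (q c).src (q c').src) ∧
      (T4GenFunBounds.gibbsMeasure (G := Matrix.specialUnitaryGroup (Fin n) ℂ) P β).real
          {U | dist1 (GaugeField.plaqHol
            (Averaging.iter (fun k => blockAvg (P := P) (j := k) (ℰ k)) K U) p) ∈ B} ≤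
        ((T4GenFunBounds.gibbsMeasure (G := Matrix.specialUnitaryGroup (Fin n) ℂ) P β).real
          {U | ∀ c : BlockIdx P.d N, dist1 (GaugeField.plaqHol
            (Averaging.iter (fun k => blockAvg (P := P) (j := k) (ℰ k)) K U) (q c)) ∈ B}) ^
          ((1 : ℝ) / (N : ℝ) ^ P.d) := by
  set v : Site P K := centreVec M p with hv
  set p' : Plaq P K := p.translate v with hp'_def
  -- the centred translate satisfies the hypotheses of files 2–3 and §2
  have hoff : ∀ j, baseOffset M p' j = centreOffset M p j := fun j => baseOffset_translate_centreVec h p j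
  have hp' : ∀ j : Fin P.d, baseOffset M p' j + extent p' j < M := fun j => by
    rw [hoff, hp'_def, extent_translate]; exact (centreOffset_bounds hM p j).1
  have hcen : ∀ j : Fin P.d, M ≤ 2 * baseOffset M p' j + extent p' j + 2 ∧ 2 * baseOffset M p' j + extent p' j ≤ M :=
    fun j => by rw [hoff, hp'_def, extent_translate]; exact (centreOffset_bounds hM p j).2
  -- the family: mirror copies of the centred translate, translated back
  refine ⟨fun c => (mirror h hN p' c).translate (-v), ?_, ⟨cubeOf M N p'.src, ?_⟩, fun c => ⟨rfl, rfl⟩, ?_, ?_⟩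
  · intro c c' hcc'
    apply mirror_injective h hN hp'
    have e : ((mirror h hN p' c).translate (-v)).translate v = ((mirror h hN p' c').translate (-v)).translate v :=
      congrArg (Plaq.translate v) hcc'
    rwa [plaq_translate_translate, plaq_translate_translate, neg_add_cancel, plaq_translate_zero,
      plaq_translate_zero] at e
  · show (mirror h hN p' (cubeOf M N p'.src)).translate (-v) = p
    rw [mirror_cubeOf h hN hp', hp'_def, plaq_translate_translate, add_neg_cancel, plaq_translate_zero]
  · intro c c' hcc'
    show M - 1 ≤ Site.tdist ((mirror h hN p' c).src + -v) ((mirror h hN p' c').src + -v)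
    rw [tdist_add_right]
    exact le_tdist_mirror h hN hp' hcen hcc'
  · -- the bound for `p'` (file 3), read back through the translation invariance (§4)
    have main := gibbs_real_iter_le_rpow_mirror P hβ ℰ hE K hK h hN hB p' hp'
    have hS₁ : MeasurableSet {V : GaugeField P K (Matrix.specialUnitaryGroup (Fin n) ℂ) |
        dist1 (GaugeField.plaqHol V p) ∈ B} :=
      (RegularGaugeGroup.measurable_dist1.comp (Missing.measurable_plaqHol _)) hB
    have hS₂ : MeasurableSet {V : GaugeField P K (Matrix.specialUnitaryGroup (Fin n) ℂ) | ∀ c : BlockIdx P.d N,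
        dist1 (GaugeField.plaqHol V ((mirror h hN p' c).translate (-v))) ∈ B} := by
      have : {V : GaugeField P K (Matrix.specialUnitaryGroup (Fin n) ℂ) | ∀ c : BlockIdx P.d N,
          dist1 (GaugeField.plaqHol V ((mirror h hN p' c).translate (-v))) ∈ B} =
          ⋂ c, {V | dist1 (GaugeField.plaqHol V ((mirror h hN p' c).translate (-v))) ∈ B} := by
        ext V; simp only [Set.mem_setOf_eq, Set.mem_iInter]
      rw [this]
      exact MeasurableSet.iInter fun c => (RegularGaugeGroup.measurable_dist1.comp (Missing.measurable_plaqHol _)) hB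
    have e₁ := gibbs_real_iter_translate P hβ ℰ hE K hS₁ v
    have e₂ := gibbs_real_iter_translate P hβ ℰ hE K hS₂ v
    simp only [Set.mem_setOf_eq, GaugeField.plaqHol_translate, plaq_translate_translate, neg_add_cancel,
      plaq_translate_zero] at e₁ e₂
    rw [← e₁, ← e₂]
    exact main

end Family

end

end Summit.QuantumFields.YangMills.Theorems.HistoryTailChessboardFamily
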